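import Mathlib
import HarnessLib
import HarnessLib.Audit
import Summits.HodgeConjecture.Statement
import Literature.AlgebraicGeometry.HodgeTheory.KaehlerEmbeddingCurrents
import Literature.AlgebraicGeometry.HodgeTheory.HardLefschetzNFold
import Literature.AlgebraicGeometry.HodgeTheory.KaehlerClass
import Summits.HodgeConjecture.HodgeConjecture.Theorems.HolomorphicityRatePolarisedLefschetzData
import HarnessLib.Audit.Status.Attr

/-!
Route: GmtVisibleFractionBootstrap

# Route GmtVisibleFractionBootstrap — a uniform visible holomorphic fraction of mass minimizers plus
form-positivity of the blown-down remainders bootstraps Lawson's positive Hodge conjecture, hence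
Hodge

It suffices to show X = Lawson's positive Hodge conjecture (PSPM 27, Conj. 5.15) for STRICTLY
strongly positive classes: on a
Chern-normalised Hodge model A of a smooth projective X, Kähler-embedded in a Euclidean space V
(tree `KaehlerEmbedding`), every rational
class c₀ ∈ H^{2p}(X) represented on A by a smooth pointwise strictly strongly positive real 2p-form
α (p + q = n, 1 ≤ p ≤ q) is algebraic.
X is the target node `PositiveRationalClassesAlgebraic`; it is cut (sketch
gmt-visible-fraction-bootstrap, reader verdict pass) into
two cruxes about the mass-minimizing integral currents T_k of the multiples k·PD(α) (tree Euclidean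
GMT currents carried by ι(A)):
K2 `VisibleFraction` — a uniform fraction c·k·|α| of the mass sits on the openly-holomorphic locus
of T_k for k ≫ 1 — and
K3 `RemainderPositivity` — weak limits of the normalised non-holomorphic remainders have classes in
the closed cone of strictly positive
closed forms — glued by the supports `FreeCycles` (the holomorphic part is an algebraic cycle,
Almgren–Morrey–Shiffman–Chow),
`ConvexBootstrap` (finite-dimensional cone iteration, provable now) and `BootstrapOfCruxes`;
`LawsonBallast` (c + N·h^p is strictly
positive) and `SetupExists` carry X to every rational (p,p)-class with 2p ≤ n,
`PolarisedLefschetzData` (shared with HolomorphicityRate) above the middle.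
Lean: `∀ (n : ℕ) (X : Literature.AlgebraicGeometry.Motives.SchemeOver ℂ) (A :
Literature.AlgebraicGeometry.HodgeTheory.HodgeModel n X) (V : Type) [NormedAddCommGroup V]
[InnerProductSpace ℝ V] [FiniteDimensional ℝ V], Nonempty
(Literature.AlgebraicGeometry.HodgeTheory.KaehlerEmbedding A V) → ∀ (p q : ℕ), p + q = n → 1 ≤ p → p
≤ q → ∀ (c₀ : Literature.AlgebraicGeometry.HodgeTheory.complexBetti X (2 * p)) (α :
Literature.Geometry.Kaehler.MForm 𝓘(ℝ, A.model) A.carrier ℝ (2 * p)),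
Literature.AlgebraicGeometry.HodgeTheory.IsRationalClass c₀ → A.FormRepresents (2 * p) α c₀ →
Literature.Geometry.Kaehler.IsSmoothForm α →
Literature.AlgebraicGeometry.HodgeTheory.IsStrictlyPositiveForm p α → c₀ ∈
Literature.AlgebraicGeometry.HodgeTheory.algebraicClasses X p`

## Assembly
Logic plus ℂ-submodule arithmetic, certified in glue.lean (`theorem closes`, no sorry): given X
smooth projective, SetupExists yields
(A, N, S, h, θ) and the Hodge-type transfer; `Nonempty (HodgeModel n X)` from A; for 2p ≤ n: p = 0
by `algebraicClasses_zero`, p ≥ 1 by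
LawsonBallast (b algebraic, c + b strictly positive rational) and the target X := BootstrapOfCruxes
FreeCycles ConvexBootstrap
VisibleFraction RemainderPositivity at (A, ℝ^N, S, p, q = n − p), then c = (c + b) − b ∈
algebraicClasses; for 2p > n by
`HardLefschetzNFold.mem_algebraicClasses_of_lt` from PolarisedLefschetzData and the lower half.

Rationale: WHY THIS LINE. Lawson (1975) reformulated Hodge as "integral mass norm = real mass norm stably" and
conjectured (Conj. 5.15, [Lawson1975MinimalVarieties],
[Lawson1975StableHomology]) that positive rational (p,p)-classes carry mass-minimizing currents that
are positive holomorphic chains; by his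
ballast remark (PSPM 27 p. 206) the strictly-positive case is equivalent to HC, and Harvey–Lawson
(arXiv:0710.3921 §6.10–6.13) single it out as
the version not killed by the Kähler counterexamples. The mechanism imported from geometric measure
theory: Federer–Fleming minimizers exist in
every multiple k·PD(α); Almgren's codimension-2 regularity + Morrey analyticity +
Shiffman/Harvey–Lawson removability + Chow make the OPENLY
HOLOMORPHIC part of ANY minimizer a closed algebraic cycle for free ([Almgren2000],
[HarveyShiffman1974], [King1971], `FreeCycles`); what is
left is quantitative — a visible fraction of the mass (K2) — and qualitative — the blown-down
remainder stays in the closed FORM-positive cone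
(K3) — and a proved convex-cone iteration (`ConvexBootstrap`) turns "a c-fraction of every strictly
positive rational class is algebraic
modulo a positive remainder" into "every strictly positive rational class is algebraic". No prior
route uses minimizers at fixed class
multiples or the mass currency: HolomorphicityRate works with pointwise nearly-holomorphic C¹
carriers along a Kodaira ray and
Donaldson–Auroux sections, HolomorphicDefect with Hermitian–Yang–Mills carriers, CrLinkCycles with
link fillings; the negatives index
(MilnorKExponential, DerivedTorelliFermat, ELineTransport) is disjoint from this line.

RANKED CRUXES. #0 PositiveRationalClassesAlgebraic (target) — Lawson's positive Hodge conjecture for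
strictly positive classes, in the tree's currency: for every Hodge model A of X admitting (why it
might fail: it is equivalent to HC itself given LawsonBallast (Lawson p. 206) — this is the declared
redirect node, decided only through K2 ∧ K3.) [Lawson1975MinimalVarieties, Lawson1975StableHomology,
HarveyLawson1982, arXiv:0710.3921]
#2 VisibleFraction (crux) — (K2, deciding) For every setup (A, S : KaehlerEmbedding A V, p + q = n,
1 ≤ p ≤ q) there is c > 0 such that for every rational [difficulty: open-problem] (why it might
fail: a "phantom tower": some strictly positive rational class all of whose large-multiple
minimizers have holomorphic fraction → 0 (nothing known forces c > 0 without ambient symmetry: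
Lawson–Simons needs P^N, Arezzo–Sun all Bergman metrics).) [Lawson1975MinimalVarieties,
LawsonSimons1973, MicallefWolfson2006, ArezzoSun2015, Federer1974RealFlatChains, Almgren2000]
#3 RemainderPositivity (crux) — (K3) For every setup and every rational class c₀ represented by a
smooth strictly strongly positive α, every sequence of [difficulty: XL] (why it might fail:
blow-downs of integral minimizers might realise Babaee–Huh / DELV-type classes: positive currents
whose CLASS is outside closure(K^p) (nef-not-psef phenomena in codim ≥ 2), e.g. remainders piling on
a rigid subvariety.) [BabaeeHuh2017, arXiv:1003.3183, Demailly1992, DemaillyAGBook, HarveyKnapp1974]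
#9 FreeCycles (support) — (the free algebraic part) For every setup there is κ > 0 such that for
every datum (c₀, α) and every minimizer T ∈ k·PD(α): [difficulty: XL] [Almgren2000,
Morrey1958AnalyticityI, HarveyShiffman1974, King1971, HarveyLawson1982, Federer1969,
GriffithsHarris1978]
#9 ConvexBootstrap (support) — (finite-dimensional convex geometry, provable now) In a
finite-dimensional real normed space with a closed convex cone P on [difficulty: provable-now]
[Lawson1975MinimalVarieties, DemaillyAGBook]
#9 BootstrapOfCruxes (support) — (analytic assembly of the target) FreeCycles → ConvexBootstrap →
VisibleFraction → RemainderPositivity → [difficulty: L] [FedererFleming1960, Federer1969,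
Lawson1975MinimalVarieties]
#9 LawsonBallast (support) — (Lawson's ballast, PSPM 27 p. 206) On a Chern-normalised Hodge model
carrying a rational class h with a smooth strictly [difficulty: L] [Lawson1975MinimalVarieties,
HarveyKnapp1974, VoisinHodgeI2002, GriffithsHarris1978]
#9 SetupExists (support) — (construction of the posited objects) Every smooth projective X of
dimension n has a Hodge model A, a Kähler embedding [difficulty: L] [GriffithsHarris1978,
VoisinHodgeI2002, Voisin2002, HarveyKnapp1974]
#9 PolarisedLefschetzData (support) — (shared verbatim with route HolomorphicityRate,
stmt-HodgeConjecture-18026) every smooth projective X carries a hard [difficulty: M]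
[VoisinHodgeI2002, GriffithsHarris1978]

TWO-LAYER PLAN. VisibleFraction ⇐ MinimalMassAsymptotics (∃ κ: κ·k·size α ≤ mass of every
representer, and minimizers have mass ≤ (1+ε)κ·k·size α for
k ≥ k₀(ε): Wirtinger lower bound + Federer's stable-norm theorem, [Federer1974RealFlatChains] §5) →
SmallDefectVisibility (∃ c δ > 0: a
minimizer within relative mass-defect δ of the calibrated bound has holomorphic variation ≥ c·mass:
the honest open core, an
ε-regularity statement at class scale) → VisibleFraction (glue proved in
bc/VisibleFraction_birth.lean). RemainderPositivity ⇐
RemainderLimitDiffusePositive (R is a positive cycle along ι charging no proper analytic subset) →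
DiffusePositiveInFormCone (such currents
have periods in closure K^p; p = 1 is Demailly 1992 regularisation) → RemainderPositivity (glue
proved in bc/RemainderPositivity_birth.lean).
First rung (BC5, plan-only): VisibleFraction for HOMOGENEOUS setups (a transitive group of
holomorphic isometries of (A, S.metric), e.g.
flat abelian varieties and flag varieties; abelian fourfolds p = 2 lie outside HC's proved regime) —
stub_rung_visibleFraction_homogeneous.

KILL CRITERIA. (i) A smooth projective X, p and a strictly positive rational class all of whose
large-multiple minimizers have holomorphic fraction → 0
refutes VisibleFraction: close --reason refuted:VisibleFraction (if the class is in the ballast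
range this also bears on HC itself —
informative either way). (ii) A sequence of minimizers in a strictly positive rational class whose
normalised remainders converge to a
current with class outside closure(K^p) refutes RemainderPositivity as typed; pivot: the existential
form (SOME minimizing sequence has
positive remainder limit) with the bootstrap re-proved for it. (iii) If the uniform-c statement dies
while a per-class c(γ) > 0 survives,
restate K2 per class and strengthen ConvexBootstrap to a rate version (repairable misstatement).
(iv) HC proved below the middle degree
elsewhere moots the route; PositiveRationalClassesAlgebraic proved directly (any method) closes it.
(v) The conjunction VisibleFraction ∧ RemainderPositivity (with the two GMT supports) yields,
through ConvexBootstrap, that every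
rational class in the OPEN strongly-positive cone is pseudo-effective: so ONE smooth projective X
and p with a strictly strongly positive
rational (p,p) class outside Psef^p(X) kills the pair jointly (and tells which of the two dies by
inspecting its minimizers). Debarre–Ein–
Lazarsfeld–Voisin ask exactly whether Psef^k = Strong^k on abelian varieties and 'suspect that this
is not the case' (arXiv:1003.3183
Problem 6.3; on E^n with E CM and on very general A × A it holds, Thm. 1–2) — a refuter's first
target; either answer is informative.

NOT DECOMPOSED YET. The two foreseen splits above are recorded as birth skeletons only
(bc/*_birth.lean), not filed as items; the normalising constant κ of
FreeCycles / MinimalMassAsymptotics (tree wedge and comass conventions) is deliberately existential;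
measurability of holLocus and
representability of T are conclusions of FreeCycles, hypotheses (binders) in RemainderPositivity;
the abelian-variety reduction
(translation averaging) and the alternative Donaldson–Auroux line to the same target are tenure
material.

CHEAPEST FALSIFIER. LITERATURE, run this session and PASSED: Lawson's abelian-fourfold class where
Conj. 5.15 fails must lie on the BOUNDARY of the positive
cone, else VisibleFraction (with c = 1 at some multiple) would already contradict a theorem (HC
holds there). Lawson states exactly this
[corpus:book:chern1975-differential-geometry p.206]: "this form lies on the boundary of the positive
harmonic forms". Primary source
Lawson, Math. Scand. 36 (1975) doi:10.7146/math.scand.a-11562 not held (want filed). NEXT cheapest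
(refuter, linear algebra on constant
forms): none of the DELV nef-non-psef classes on E^n / A × A (arXiv:1003.3183 Thm. 1–2) has a
strictly strongly positive constant-form
representative — they must not, since there Psef = Strong; a positive answer kills
RemainderPositivity ∧ VisibleFraction jointly on an
abelian fourfold.

NUMBERS. Almgren: dim Sing(T) ≤ 2q − 2 for 2q-dimensional mass minimizers [Almgren2000];
Shiffman/Harvey–Lawson/King: closed positive (or
rectifiable d-closed (q,q)) currents extend across closed sets of H^{2q−1}-measure 0
[HarveyShiffman1974, King1971]; Lawson–Simons: stable
⟹ complex in P^N [LawsonSimons1973]; Micallef–Wolfson: minimizing 2-spheres in non-holomorphic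
classes exist on some Kähler surfaces
[MicallefWolfson2006] (why c > 0 cannot come from local stability alone); Kollár: small multiples
fail (IntegralCoefficients barrier) —
K2 only speaks about k ≥ k₀.

DEFINITION REQUESTS. None outstanding: the notions the sketch needed (strongly positive cone via
pullbacks of ω^p along ℂ-linear maps to ℂ^p, strict
positivity via intrinsicInterior, FormRepresents, Current.IsCycle, KaehlerEmbedding with
pullbackForm / pairing / size / Represents /
IsMassMinimizing / holLocus) LANDED this session as
Literature/AlgebraicGeometry/HodgeTheory/KaehlerEmbeddingCurrents.lean (p169649,
commit 406bf9d5; cites HarveyKnapp1974, Lawson1975MinimalVarieties, Federer1969, King1971). Wanted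
text: doi:10.7146/math.scand.a-11562.

Novelty: Searches (2026-08-17, sketch seat + this seat): `lit search --hybrid "area-minimizing integral
currents Kähler manifold holomorphic
subvarieties regular set Almgren"` (15 held hits, none on point); `lit read
book:chern1975-differential-geometry --pages 198-210` (Lawson
PSPM 27 §5: Conj. 5.15, p. 206 ballast ≡ HC and the T⁸ boundary class — READ); `lit read
arXiv:0710.3921` §6 (Harvey–Lawson 2009,
6.8–6.13 — READ); `lit search "Lawson stable homology flat torus"`, `lit search "positive (p,p)
forms strongly positive cone Harvey Knapp"`
(held: HarveyKnapp1974 via citing papers); galaxy `"mass minimizing|holomorphic chain"`, `"stable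
homology|mass norm"` --star all (hits:
Lawson–Simons 1973, Harvey–Lawson calibrated geometries, no visible-fraction statement);
crossref/zbMATH look-ups Federer 1974, Alexander
1997, Rivière–Tian 2009, De Lellis–Spadaro 2014–16, Wolfson 1989, Micallef–Wolfson 2006, Arezzo–Sun
2015.
Nearest prior art found: Lawson1975MinimalVarieties (Conj. 5.15 + the ballast equivalence — the
reformulation, NOT claimed);
arXiv:0710.3921 §6.10–6.13 (the positivity version singled out; "no proof by standard regularity
methods"); LawsonSimons1973 /
ArezzoSun2015 / MicallefWolfson2006 (holomorphicity from stability: the method ceiling); in-hub: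
route HolomorphicityRate (pointwise
rate on AH carriers) and card exact-stable-mass-norm (variant reformulation; its refuted cruxes are
not used).
Delta: the CUT of Lawson's conjecture into a uniform visible-fraction estimate for  [refs: 0710.3921, book:chern1975-differential-geometry, paper:arxiv-math_0505440, HarveyKnapp1974, LawsonSimons1973, ArezzoSun2015, MicallefWolfson2006]

Barriers (technique_class: mass-minimizing-currents, strongly-positive, cone-bootstrap): - technique_class: mass-minimizing-currents, strongly-positive-forms, positive-currents,
cone-bootstrap
- Literature.Barriers.HodgeConjecture.BabaeeHuh2017_HCplus_false: (Demailly's HC⁺ refuted: a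
strongly positive closed (2,2)-CURRENT on a toric fourfold that is no weak limit of positive
combinations of algebraic surfaces; `PositiveCurrentsBarrier : … → ¬PositiveCycleApproximation 2 2`)
OUTSIDE the refuted class: the line never approximates a positive current by effective cycles and
never represents a class by an arbitrary positive current — positivity enters only through smooth
strictly STRONGLY positive FORMS (classes in the open cone K^p: the barrier's own evasion E3 "class
level") and through integral mass-MINIMIZERS, whose holomorphic part is an honest analytic cycle
(FreeCycles) while K3 asks only that the CLASS of the blown-down remainder lie in the closed
strictly-positive FORM cone; the Babaee–Huh current has an effective class, so it is no witness
against K2/K3; the bet K3 makes explicit (Kill criteria (ii),(v)) is Debarre–Ein–Lazarsfeld–Voisin's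
Problem 6.3 (Psef^k = Strong^k on abelian varieties; arXiv:1003.3183), and the WEAK-cone version of
K2 ∧ K3 is already refuted on E^4 by their Thm. 1 + HC(E^4), which is why every cone here is the
strong one.
- Literature.Barriers.HodgeConjecture.Kollar1992_nonTorsionClass_notAlgebraic: (a non-torsion
integral Hodge class, no multiple-free property of which is algebraic) respected by construction —
K2 speaks only about k ≥

sub-problem: HodgeConjecture · status: draft · opened planner-type-94e8898ca6-0 2026-08-17T16:22:47Z · rev 3 · ledger route-HodgeConjecture-GmtVisibleFractionBootstrap
GENERATED by the gate from the ledger (D-0016/17). Provers cite these decls: `theorem foo : Summit.HodgeConjecture.HodgeConjecture.Theses.GmtVisibleFractionBootstrap.<Decl> := …` in Summits/HodgeConjecture/HodgeConjecture/Theorems/<Name>.lean.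
-/

namespace Summit.HodgeConjecture.HodgeConjecture.Theses.GmtVisibleFractionBootstrap

open scoped BigOperators Topology Manifold Classical MeasureTheory ProbabilityTheory Matrix InnerProductSpace ComplexConjugate ContinuousMap
open Filter Set Function TopologicalSpace MeasureTheory

attribute [summit_statement] _root_.HodgeConjecture

/-- item stmt-HodgeConjecture-18329 · target · rank 0 · open · by planner
why it might fail: it is equivalent to HC itself given LawsonBallast (Lawson, PSPM 27 p. 206) — the declared redirect node, decided only through VisibleFraction ∧ RemainderPositivity via BootstrapOfCruxes; Lawson's own T^8 boundary class shows the closed-cone version fails.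
sources: Lawson1975MinimalVarieties, Lawson1975StableHomology, HarveyLawson1982, arXiv:0710.3921
[target] Lawson's positive Hodge conjecture for strictly positive classes, in the tree's currency:
for every Hodge model A of X admitting -/
@[route_item "route-HodgeConjecture-GmtVisibleFractionBootstrap"]
def PositiveRationalClassesAlgebraic : Prop :=
  ∀ (n : ℕ) (X : Literature.AlgebraicGeometry.Motives.SchemeOver ℂ) (A : Literature.AlgebraicGeometry.HodgeTheory.HodgeModel n X) (V : Type) [NormedAddCommGroup V] [InnerProductSpace ℝ V] [FiniteDimensional ℝ V], Nonempty (Literature.AlgebraicGeometry.HodgeTheory.KaehlerEmbedding A V) → ∀ (p q : ℕ), p + q = n → 1 ≤ p → p ≤ q → ∀ (c₀ : Literature.AlgebraicGeometry.HodgeTheory.complexBetti X (2 * p)) (α : Literature.Geometry.Kaehler.MForm 𝓘(ℝ, A.model) A.carrier ℝ (2 * p)), Literature.AlgebraicGeometry.HodgeTheory.IsRationalClass c₀ → A.FormRepresents (2 * p) α c₀ → Literature.Geometry.Kaehler.IsSmoothForm α → Literature.AlgebraicGeometry.HodgeTheory.IsStrictlyPositiveForm p α → c₀ ∈ Literature.AlgebraicGeometry.HodgeTheory.algebraicClasses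 X p

/-- item stmt-HodgeConjecture-18330 · crux · rank 2 · open · by planner
why it might fail: a "phantom tower": some strictly positive rational class all of whose large-multiple minimizers have holomorphic fraction → 0 (nothing known forces c > 0 without ambient symmetry: Lawson–Simons needs P^N, Arezzo–Sun all Bergman metrics; Micallef–Wolfson: non-holomorphic minimizers exist).
sources: Lawson1975MinimalVarieties, LawsonSimons1973, MicallefWolfson2006, ArezzoSun2015, Federer1974RealFlatChains, Almgren2000
[crux] (K2, deciding) For every setup (A, S : KaehlerEmbedding A V, p + q = n, 1 ≤ p ≤ q) there is c
> 0 such that for every rational [difficulty: open-problem] -/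
@[route_item "route-HodgeConjecture-GmtVisibleFractionBootstrap", crux]
def VisibleFraction : Prop :=
  ∀ (n : ℕ) (X : Literature.AlgebraicGeometry.Motives.SchemeOver ℂ) (A : Literature.AlgebraicGeometry.HodgeTheory.HodgeModel n X) [Fact (Module.finrank ℝ A.model = 2 * n)] [MeasurableSpace A.model] [BorelSpace A.model] (V : Type) [NormedAddCommGroup V] [InnerProductSpace ℝ V] [FiniteDimensional ℝ V] [MeasurableSpace V] [BorelSpace V] (S : Literature.AlgebraicGeometry.HodgeTheory.KaehlerEmbedding A V) (p q : ℕ) (hpq : p + q = n), 1 ≤ p → p ≤ q → ∃ c : ℝ, 0 < c ∧ ∀ (c₀ : Literature.AlgebraicGeometry.HodgeTheory.complexBetti X (2 * p)) (α : Literature.Geometry.Kaehler.MForm 𝓘(ℝ, A.model) A.carrier ℝ (2 * p)), Literature.AlgebraicGeometry.HodgeTheory.IsRationalClass c₀ → A.FormRepresents (2 * p) α c₀ → Literature.Geometry.Kaehler.IsSmoothForm α → Literature.AlgebraicGeometry.HodgeTheory.IsStrictlyPositiveForm p α → ∃ k₀ : ℕ, ∀ k : ℕ, k₀ ≤ k →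 ∀ T : Literature.Geometry.GeometricMeasureTheory.Current (⊤ : Opens V) (2 * q), S.IsMassMinimizing hpq α k T → ENNReal.ofReal (c * k * S.size hpq α) ≤ T.variation (S.holLocus p T)

/-- item stmt-HodgeConjecture-18331 · crux · rank 3 · open · by planner
why it might fail: blow-downs of integral minimizers might realise Babaee–Huh / DELV-type classes: positive currents whose CLASS is outside closure(K^p) (nef-not-psef phenomena in codim ≥ 2, arXiv:1003.3183 Problem 6.3), e.g. remainders piling on a rigid subvariety.
sources: BabaeeHuh2017, arXiv:1003.3183, Demailly1992, DemaillyAGBook, HarveyKnapp1974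
[crux] (K3) For every setup and every rational class c₀ represented by a smooth strictly strongly
positive α, every sequence of [difficulty: XL] -/
@[route_item "route-HodgeConjecture-GmtVisibleFractionBootstrap", crux]
def RemainderPositivity : Prop :=
  ∀ (n : ℕ) (X : Literature.AlgebraicGeometry.Motives.SchemeOver ℂ) (A : Literature.AlgebraicGeometry.HodgeTheory.HodgeModel n X) [Fact (Module.finrank ℝ A.model = 2 * n)] [MeasurableSpace A.model] [BorelSpace A.model] (V : Type) [NormedAddCommGroup V] [InnerProductSpace ℝ V] [FiniteDimensional ℝ V] [MeasurableSpace V] [BorelSpace V] (S : Literature.AlgebraicGeometry.HodgeTheory.KaehlerEmbedding A V) (p q : ℕ) (hpq : p + q = n), 1 ≤ p → p ≤ q → ∀ (c₀ : Literature.AlgebraicGeometry.HodgeTheory.complexBetti X (2 * p)) (α : Literature.Geometry.Kaehler.MForm 𝓘(ℝ, A.model) A.carrier ℝ (2 * p)), Literature.AlgebraicGeometry.HodgeTheory.IsRationalClass c₀ → A.FormRepresents (2 * p) α c₀ → Literature.Geometry.Kaehler.IsSmoothForm α → Literature.AlgebraicGeometry.HodgeTheory.IsStrictlyPositiveForm p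 α → ∀ (k : ℕ → ℕ) (T : ℕ → Literature.Geometry.GeometricMeasureTheory.Current (⊤ : Opens V) (2 * q)), Tendsto k atTop atTop → (∀ j, S.IsMassMinimizing hpq α (k j) (T j)) → ∀ (hT : ∀ j, (T j).IsRepresentable) (hm : ∀ j, MeasurableSet (S.holLocus p (T j))) (R : Literature.Geometry.GeometricMeasureTheory.Current (⊤ : Opens V) (2 * q)), (∀ Φ, Tendsto (fun j ↦ ((T j) Φ - (hT j).restrictSet _ (hm j) Φ) / (k j)) atTop (𝓝 (R Φ))) → ∃ β : ℕ → Literature.Geometry.Kaehler.MForm 𝓘(ℝ, A.model) A.carrier ℝ (2 * p), (∀ i, Literature.Geometry.Kaehler.IsSmoothForm (β i) ∧ Literature.Geometry.Kaehler.IsClosedForm (β i) ∧ Literature.AlgebraicGeometry.HodgeTheory.IsStrictlyPositiveForm p (β i)) ∧ ∀ Φ : Literature.Geometry.GeometricMeasureTheory.TestForm (⊤ : Opens V) (2 * q), Literature.Geometry.Kaehler.IsClosedForm (S.pullbackForm Φ) → Tendsto (fun i ↦ S.pairing hpq (β i) Φ) atTop (𝓝 (R Φ))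

/-- item stmt-HodgeConjecture-18026 · support · rank 9 · closed · proved by Summit.HodgeConjecture.HodgeConjecture.Theorems.polarisedLefschetzData_proof @ 934a421cd36a (prover) · by planner
sources: VoisinHodgeI2002, GriffithsHarris1978
[support] anti-vacuity of the pin, consumed by `closes`: every smooth projective n-fold carries a
hard-Lefschetz datum Lambda whose class h = Lambda.hyperplaneClass is KAEHLER (IsKaehlerClass n X h)
and all of whose cup powers h^p = cupPowTwo h p are algebraic. Provable now from the tree: h := r
[theta_iota] for the restricted Fubini-Study form of a projective embedding and the r > 0 of
exists_pos_smul_isRationalClass_of_pullback_eq_fubiniStudy (HardLefschetzNFoldHolds); Lambda from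
HodgeModel.exists_hardLefschetzNFold_of_pullback_eq_fubiniStudy_smul (w := r); Kaehler by
HodgeModel.isKaehlerClassVia_of_pullback_eq_fubiniStudyPullbackForm + IsKaehlerClassVia.smul_of_pos
+ IsKaehlerClassVia.isKaehlerClass (KaehlerClass); powers algebraic by induction from
algebraicClasses_zero (h^0 = 1), cupPowTwo_succ, the field
Lambda.lefschetzOperator_mem_algebraicClasses and even-degree commutativity
cupPowTwo_cupProduct_comm / lefschetzPow_eq_cupPowTwo_cupProduct (HodgeRiemannDegreeOneProofs).
[difficulty: M] -/
@[route_item "route-HodgeConjecture-GmtVisibleFractionBootstrap", crux]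
def PolarisedLefschetzData : Prop :=
  ∀ (n : ℕ) (X : Literature.AlgebraicGeometry.Motives.SchemeOver ℂ), Literature.AlgebraicGeometry.Motives.IsSmoothProjective n X → ∃ Λ : Literature.AlgebraicGeometry.HodgeTheory.HardLefschetzNFold n X, Literature.AlgebraicGeometry.HodgeTheory.IsKaehlerClass n X Λ.hyperplaneClass ∧ ∀ p : ℕ, Literature.AlgebraicGeometry.HodgeTheory.cupPowTwo Λ.hyperplaneClass p ∈ Literature.AlgebraicGeometry.HodgeTheory.algebraicClasses X p

/-- `PolarisedLefschetzData` holds: proved by `Summit.HodgeConjecture.HodgeConjecture.Theorems.polarisedLefschetzData_proof` @ 934a421cd36a. -/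
theorem PolarisedLefschetzData_holds : PolarisedLefschetzData := _root_.Summit.HodgeConjecture.HodgeConjecture.Theorems.polarisedLefschetzData_proof

/-- item stmt-HodgeConjecture-18332 · support · rank 9 · open · by planner
sources: Almgren2000, Morrey1958AnalyticityI, HarveyShiffman1974, King1971, HarveyLawson1982, Federer1969
[support] (the free algebraic part) For every setup there is κ > 0 such that for every datum (c₀, α)
and every minimizer T ∈ k·PD(α): [difficulty: XL] -/
@[route_item "route-HodgeConjecture-GmtVisibleFractionBootstrap", crux]
def FreeCycles : Prop :=
  ∀ (n : ℕ) (X : Literature.AlgebraicGeometry.Motives.SchemeOver ℂ) (A : Literature.AlgebraicGeometry.HodgeTheory.HodgeModel n X) [Fact (Module.finrank ℝ A.model = 2 * n)] [MeasurableSpace A.model] [BorelSpace A.model] (V : Type) [NormedAddCommGroup V] [InnerProductSpace ℝ V] [FiniteDimensional ℝ V] [MeasurableSpace V] [BorelSpace V] (S : Literature.AlgebraicGeometry.HodgeTheory.KaehlerEmbedding A V) (p q : ℕ) (hpq : p + q = n), 1 ≤ p → p ≤ q → ∃ κ : ℝ, 0 < κ ∧ ∀ (c₀ : Literature.AlgebraicGeometry.HodgeTheory.complexBetti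 X (2 * p)) (α : Literature.Geometry.Kaehler.MForm 𝓘(ℝ, A.model) A.carrier ℝ (2 * p)), Literature.AlgebraicGeometry.HodgeTheory.IsRationalClass c₀ → A.FormRepresents (2 * p) α c₀ → Literature.Geometry.Kaehler.IsSmoothForm α → Literature.AlgebraicGeometry.HodgeTheory.IsStrictlyPositiveForm p α → ∀ (k : ℕ) (T : Literature.Geometry.GeometricMeasureTheory.Current (⊤ : Opens V) (2 * q)), S.IsMassMinimizing hpq α k T → ∃ (a : Literature.AlgebraicGeometry.HodgeTheory.complexBetti X (2 * p)) (αZ : Literature.Geometry.Kaehler.MForm 𝓘(ℝ, A.model) A.carrier ℝ (2 * p)) (hT : T.IsRepresentable) (hm : MeasurableSet (S.holLocus p T)), a ∈ Literature.AlgebraicGeometry.HodgeTheory.algebraicClasses X p ∧ A.FormRepresents (2 * p) αZ a ∧ Literature.Geometry.Kaehler.IsSmoothForm αZ ∧ (hT.restrictSet _ hm).IsCycle ∧ (∀ Φ, S.IsPositiveTestForm q Φ → 0 ≤ hT.restrictSet _ hm Φ) ∧ (∀ Φ, Literature.Geometry.Kaehler.IsClosedForm (S.pullbackForm Φ) → hT.restrictSet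 _ hm Φ = S.pairing hpq αZ Φ) ∧ S.size hpq αZ = κ * (T.variation (S.holLocus p T)).toReal

/-- item stmt-HodgeConjecture-18333 · support · rank 9 · closed · proved by Summit.HodgeConjecture.HodgeConjecture.Theorems.convexBootstrap_proof @ a6222bf9ed63 (prover) · by planner
sources: Lawson1975MinimalVarieties, DemaillyAGBook
[support] (finite-dimensional convex geometry, provable now) In a finite-dimensional real normed
space with a closed convex cone P on [difficulty: provable-now] -/
@[route_item "route-HodgeConjecture-GmtVisibleFractionBootstrap", crux]
def ConvexBootstrap : Prop :=
  ∀ (W : Type) [NormedAddCommGroup W] [NormedSpace ℝ W] [FiniteDimensional ℝ W] (ℓ : W →L[ℝ] ℝ) (P Psef K D : Set W), IsClosed P → Convex ℝ P → (∀ x ∈ P, ∀ t : ℝ, 0 ≤ t → t • x ∈ P) → (∀ x ∈ P, 0 ≤ ℓ x) → (∀ x ∈ P, ℓ x = 0 → x = 0) → IsClosed Psef → Convex ℝ Psef → (0 : W) ∈ Psef → (∀ x ∈ Psef, ∀ y ∈ Psef, x + y ∈ Psef) → (∀ x ∈ Psef, ∀ t : ℝ, 0 ≤ t → t • x ∈ Psef)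 → Psef ⊆ P → IsOpen K → Convex ℝ K → (∀ x ∈ K, ∀ t : ℝ, 0 < t → t • x ∈ K) → K ⊆ P → D ⊆ K → K ⊆ closure D → (∃ c : ℝ, 0 < c ∧ ∀ y ∈ D, ∀ ε : ℝ, 0 < ε → ∃ e ∈ Psef, y - e ∈ closure K ∧ c * ℓ y - ε ≤ ℓ e) → K ⊆ Psef

/-- item stmt-HodgeConjecture-18334 · support · rank 9 · open · by planner
sources: FedererFleming1960, Federer1969, Lawson1975MinimalVarieties
[support] (analytic assembly of the target) FreeCycles → ConvexBootstrap → VisibleFraction →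
RemainderPositivity → [difficulty: L] -/
@[route_item "route-HodgeConjecture-GmtVisibleFractionBootstrap", crux]
def BootstrapOfCruxes : Prop :=
  FreeCycles → ConvexBootstrap → VisibleFraction → RemainderPositivity → PositiveRationalClassesAlgebraic

/-- item stmt-HodgeConjecture-18335 · support · rank 9 · open · by planner
sources: Lawson1975MinimalVarieties, HarveyKnapp1974, VoisinHodgeI2002, GriffithsHarris1978
[support] (Lawson's ballast, PSPM 27 p. 206) On a Chern-normalised Hodge model carrying a rational
class h with a smooth strictly [difficulty: L] -/
@[route_item "route-HodgeConjecture-GmtVisibleFractionBootstrap", crux]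
def LawsonBallast : Prop :=
  ∀ (n : ℕ) (X : Literature.AlgebraicGeometry.Motives.SchemeOver ℂ) (A : Literature.AlgebraicGeometry.HodgeTheory.HodgeModel n X), A.IsChernNormalised → ∀ (h : Literature.AlgebraicGeometry.HodgeTheory.complexBetti X 2) (θ : Literature.Geometry.Kaehler.MForm 𝓘(ℝ, A.model) A.carrier ℝ 2), Literature.AlgebraicGeometry.HodgeTheory.IsRationalClass h → A.FormRepresents 2 θ h → Literature.Geometry.Kaehler.IsSmoothForm θ → Literature.AlgebraicGeometry.HodgeTheory.IsStrictlyPositiveForm 1 θ → (∀ p : ℕ, Literature.AlgebraicGeometry.HodgeTheory.cupPowTwo h p ∈ Literature.AlgebraicGeometry.HodgeTheory.algebraicClasses X p) → ∀ p : ℕ, 1 ≤ p → ∀ c : Literature.AlgebraicGeometry.HodgeTheory.complexBetti X (2 * p), Literature.AlgebraicGeometry.HodgeTheory.IsRationalClass c → A.pullback (2 * p) c ∈ A.hodgePQ (2 * p) p p → ∃ (b : Literature.AlgebraicGeometry.HodgeTheory.complexBetti X (2 * p)) (α : Literature.Geometry.Kaehler.MForm 𝓘(ℝ, A.model) A.carrier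 ℝ (2 * p)), b ∈ Literature.AlgebraicGeometry.HodgeTheory.algebraicClasses X p ∧ Literature.AlgebraicGeometry.HodgeTheory.IsRationalClass (c + b) ∧ A.FormRepresents (2 * p) α (c + b) ∧ Literature.Geometry.Kaehler.IsSmoothForm α ∧ Literature.AlgebraicGeometry.HodgeTheory.IsStrictlyPositiveForm p α

/-- item stmt-HodgeConjecture-18336 · support · rank 9 · open · by planner
sources: GriffithsHarris1978, VoisinHodgeI2002, Voisin2002, HarveyKnapp1974
[support] (construction of the posited objects) Every smooth projective X of dimension n has a Hodge
model A, a Kähler embedding [difficulty: L] -/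
@[route_item "route-HodgeConjecture-GmtVisibleFractionBootstrap", crux]
def SetupExists : Prop :=
  ∀ (n : ℕ) (X : Literature.AlgebraicGeometry.Motives.SchemeOver ℂ), Literature.AlgebraicGeometry.Motives.IsSmoothProjective n X → ∃ (A : Literature.AlgebraicGeometry.HodgeTheory.HodgeModel n X) (N : ℕ) (_S : Literature.AlgebraicGeometry.HodgeTheory.KaehlerEmbedding A (EuclideanSpace ℝ (Fin N))) (h : Literature.AlgebraicGeometry.HodgeTheory.complexBetti X 2) (θ : Literature.Geometry.Kaehler.MForm 𝓘(ℝ, A.model) A.carrier ℝ 2), Literature.AlgebraicGeometry.HodgeTheory.IsRationalClass h ∧ A.FormRepresents 2 θ h ∧ Literature.Geometry.Kaehler.IsSmoothForm θ ∧ Literature.AlgebraicGeometry.HodgeTheory.IsStrictlyPositiveForm 1 θ ∧ (∀ p : ℕ, Literature.AlgebraicGeometry.HodgeTheory.cupPowTwo h p ∈ Literature.AlgebraicGeometry.HodgeTheory.algebraicClasses X p) ∧ ∀ (k p q : ℕ) (c : Literature.AlgebraicGeometry.HodgeTheory.complexBetti X k), Literature.AlgebraicGeometry.HodgeTheory.IsOfHodgeType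 n X k p q c → A.pullback k c ∈ A.hodgePQ k p q

/-- item stmt-HodgeConjecture-18337 · assembly · rank 1 · closed · proved by Summit.HodgeConjecture.HodgeConjecture.Theorems.gmtVisibleFractionBootstrap_assembly_proof @ 95ece4a6418f (prover) · by planner
sources: Lawson1975MinimalVarieties, VoisinHodgeI2002
[assembly] VisibleFraction → RemainderPositivity → FreeCycles → ConvexBootstrap → BootstrapOfCruxes
→ LawsonBallast → SetupExists → PolarisedLefschetzData → HodgeConjecture -/
@[route_item "route-HodgeConjecture-GmtVisibleFractionBootstrap"]
def Assembly : Prop :=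
  VisibleFraction → RemainderPositivity → FreeCycles → ConvexBootstrap → BootstrapOfCruxes → LawsonBallast → SetupExists → PolarisedLefschetzData → _root_.HodgeConjecture

/-! D-0027 §2.1 — DECIDING THEOREM (planner-authored via `route open/edit --closes-file`; by planner-rbadge-HodgeConjecture-GmtVisibleFract-85aded52-g2-0 2026-08-17T17:45:01Z):
its hypotheses are this route's items and its conclusion the sub-problem Statement (glue_lint), and it elaborates with this file. -/

-- D-0027 §2.1 deciding theorem of route GmtVisibleFractionBootstrap (type-sketch seat type-94e8898ca6, 2026-08-17;
-- re-glued by route-repair seat rbadge-…-g2, 2026-08-17: the `Assembly` item is PROVED inline and applied, so it is in the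
-- cone of `closes` instead of an unused/exempt declaration — binders and mathematics unchanged).
-- Binders: the two cruxes VisibleFraction (K2) and RemainderPositivity (K3); the supports FreeCycles, ConvexBootstrap,
-- the analytic assembly BootstrapOfCruxes (FreeCycles → ConvexBootstrap → VisibleFraction → RemainderPositivity →
-- PositiveRationalClassesAlgebraic = Lawson's positive Hodge conjecture 5.15 for strictly positive classes), LawsonBallast
-- (every rational (p,p)-class is a difference "strictly positive rational class − algebraic class"), SetupExists (a Hodge
-- model with a Kähler embedding into some ℝᴺ, a strictly positive rational polarisation form with algebraic powers, computing
-- Hodge types) and PolarisedLefschetzData (hard Lefschetz datum, shared with HolomorphicityRate, used only above the middle).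
-- Logic + ℂ-submodule arithmetic only: lower half 2p ≤ n — p = 0 by algebraicClasses_zero; 1 ≤ p: ballast + positive case on
-- the model of SetupExists, subtract the algebraic ballast; upper half n < 2p by HardLefschetzNFold.mem_algebraicClasses_of_lt.
@[closes "route-HodgeConjecture-GmtVisibleFractionBootstrap"] theorem closes (vf : VisibleFraction) (rp : RemainderPositivity) (fc : FreeCycles) (cb : ConvexBootstrap)
    (boot : BootstrapOfCruxes) (lb : LawsonBallast) (se : SetupExists) (pl : PolarisedLefschetzData) :
    _root_.HodgeConjecture :=
  -- `Assembly` (item, kind assembly) is exactly the curried form of this theorem: prove it here and apply it, so the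
  -- item is part of the argument of `closes` (D-0027 §2.1) rather than an exempt declaration.
  have hA : Assembly := by
    intro vf rp fc cb boot lb se pl n X hX
    obtain ⟨A, N, S, h, θ, hh, hθh, hθs, hθp, halg, hmodel⟩ := se n X hX
    refine ⟨⟨A⟩, ?_⟩
    have kra : PositiveRationalClassesAlgebraic := boot fc cb vf rp
    obtain ⟨Λ, -, -⟩ := pl n X hX
    have lower : ∀ p : ℕ, 2 * p ≤ n →
        ∀ c : Literature.AlgebraicGeometry.HodgeTheory.complexBetti X (2 * p),
          Literature.AlgebraicGeometry.HodgeTheory.IsRationalClass c →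
          Literature.AlgebraicGeometry.HodgeTheory.IsOfHodgeType n X (2 * p) p p c →
          c ∈ Literature.AlgebraicGeometry.HodgeTheory.algebraicClasses X p := by
      intro p h2p c hc hH
      rcases Nat.eq_zero_or_pos p with rfl | hp1
      · rw [Literature.AlgebraicGeometry.HodgeTheory.algebraicClasses_zero]
        exact Submodule.mem_top
      · obtain ⟨b, α, hb, hrat, hrep, hsm, hpos⟩ :=
          lb n X A S.isChernNormalised h θ hh hθh hθs hθp halg p hp1 c hc (hmodel _ _ _ c hH)
        have hcb : c + b ∈ Literature.AlgebraicGeometry.HodgeTheory.algebraicClasses X p :=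
          kra n X A (EuclideanSpace ℝ (Fin N)) ⟨S⟩ p (n - p) (by omega) hp1 (by omega) (c + b) α hrat
            hrep hsm hpos
        simpa using Submodule.sub_mem _ hcb hb
    intro p c hc hH
    by_cases h2p : 2 * p ≤ n
    · exact lower p h2p c hc hH
    · exact Λ.mem_algebraicClasses_of_lt (by omega)
        (fun c' hc' hH' ↦ lower (n - p) (by omega) c' hc' hH') c hc hH
  hA vf rp fc cb boot lb se pl

end Summit.HodgeConjecture.HodgeConjecture.Theses.GmtVisibleFractionBootstrap
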